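import Summits.CriticalPhenomena.PercolationContinuityZ3.Theorems.Transplant.PlanarSkeletonFrmFromDefs
import Summits.CriticalPhenomena.PercolationContinuityZ3.Theorems.Transplant.SkelFrmFrom1ChoiceDefs
import Summits.CriticalPhenomena.PercolationContinuityZ3.Theorems.Transplant.SkelFrm1ChoiceDefs
import Summits.CriticalPhenomena.PercolationContinuityZ3.Theorems.Transplant.SkelFrmFromBParamsLOA
import Summits.CriticalPhenomena.PercolationContinuityZ3.Theorems.Transplant.SkelFrmBParamsLOA
import Summits.CriticalPhenomena.PercolationContinuityZ3.Theorems.Transplant.SkelFrmFrom1ParamsLBL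
import Summits.CriticalPhenomena.PercolationContinuityZ3.Theorems.Transplant.SkelFrm1ParamsLBL
import Summits.CriticalPhenomena.PercolationContinuityZ3.Theorems.Transplant.SkelPhiCellsSmallMS
import Summits.CriticalPhenomena.PercolationContinuityZ3.Theorems.Transplant.SkelPhiConcScheduleN
import HarnessLib
import Summits.CriticalPhenomena.PercolationContinuityZ3.Theorems.Transplant.SkelFrmBChoiceDefs
/-!
# U-WAVE PORT (RULING D-U, lead g21 2026-08-26; WAVE-U-MANIFEST v3.0 row «SkelFrmBChoiceDefs» ↦ «SkelFrmFromBChoiceDefs») of the tree module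
# `Transplant/SkelFrmBChoiceDefs` onto the carrier `PlanarSkeletonFrmFrom` (frames only, cylinders connected from width `ℓ₀` on)

ORIGINAL TITLE: N2 (frames-only node `SamePDropOfSkeletonFrm₁`, OPEN), WAVE 1: THE CHOICE FUNCTION OF RECORD OVER `Frm` / `DataNS` / STAGGERED CELLS `PCells2S` —

builds on p205010 (kernel theorem, internal audit signed; external expert review pending) — nothing in this file uses p205010; NOTHING is claimed about the
OPEN node U `SamePDropOfSkeletonFrmFrom₁` (nor U_s / the end state).  Lane `prim-bschramm`, seat `prim-hp-8 gen 53 (U-wave port pen; tool of record = p3-g26 port_u.py)`; helper file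
(`--supports stmt-CriticalPhenomena-4575 --as helper`).  PORT RULES r1–r4 of RULING D-U: declaration order and proof texts are those of the original,
byte-identical except (i) the carrier token `PlanarSkeletonFrm ↦ PlanarSkeletonFrmFrom` (binders, `namespace`/`end` lines, qualified names of twinned
declarations), (ii) carrier-FREE declarations of the original (φ-level `Skelφ…` blocks and namespace-only arithmetic residents) are NOT re-declared —
this file imports the original and `export`s the twin-free residents (POLICY T / treatment (m1)); residents whose statement mentions a twinned
constant are copied, (iii) every carrier-binding declaration keeps its explicit binder `(Φ : PlanarSkeletonFrmFrom G)` in its own signature (r2).  Docstrings and citations are the original's.  Manifest row idx 35 (level 7; flags verbatim|DEF-ROW); filed by the hp-8 lineage under RULING M-11 (family P-hp8).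
-/

noncomputable section

open scoped Classical

namespace Summit.CriticalPhenomena.PercolationContinuityZ3.Theorems.Transplant

open MeasureTheory Literature.Probability.Percolation Literature.Probability.LatticeModels SimpleGraph KNCells
open Literature.Barriers.CriticalPhenomena (HasExponentialGrowth)

namespace PlanarSkeletonFrmFrom

open SkelConc (Consts)
open BoxProdZ2 (ConcRadiiG)
open Skelφ (oriφ trφ)
open Skelφ.StepI (DataN DataNS OutNS)

namespace NegB

open Neg

/-! ## §1 The creep slot and the staggered cells of record -/

/-- **A creep slot over `Frm`**: the creep per axis, in fine cells, as a function of everything p-fixed (constants, skeleton, base vertex, density, merged record WITH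
selectors, box and width values). [this work] -/
def CSlot : Type 1 :=
  ∀ (κ : Consts) {V : Type} [DecidableEq V] [Countable V] {G : SimpleGraph V} [G.LocallyFinite],
    PlanarSkeletonFrmFrom G → V → unitInterval → Skelφ.StepI.DataNS V → ℕ → ℕ → Fin 2 → ℕ

/-- The zero creep (sanity value: `fcellsS … 0` is `fcellsA` with `c = 0`). [this work] -/
def CSlot.zero : CSlot := fun _ _ _ _ _ _ _ _ _ _ _ _ _ => 0

/-- **An arrival-box slot over `Frm`**: the arrival half-widths per axis, in fine cells (the K-G corridor's last core must sit inside `Mb b (x+du)` about `cenS (x+du)`;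
ledger rows `10·u_i ≤ b_i ≤ 3·r_i`), as a function of the same data as the creep. [this work] -/
def BSlot : Type 1 :=
  ∀ (κ : Consts) {V : Type} [DecidableEq V] [Countable V] {G : SimpleGraph V} [G.LocallyFinite],
    PlanarSkeletonFrmFrom G → V → unitInterval → Skelφ.StepI.DataNS V → ℕ → ℕ → Fin 2 → ℕ

/-- N1's arrival half-widths as a slot value (sanity value `b i := r i / 4 = 10·Kq` strides, `b0TA`; NOT the value of record under (R-22)). [this work] -/
def BSlot.quarter : BSlot := fun κ _ _ _ _ _ Φ t p D g f i => (fcellsA κ Φ t p D g f).r i / 4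

section Values

variable (κ : Consts) {V : Type} [DecidableEq V] [Countable V] {G : SimpleGraph V} [G.LocallyFinite] (Φ : PlanarSkeletonFrmFrom G) (t : V)
  (p : unitInterval) (D : DataNS V) (g f : ℕ) (c : Fin 2 → ℕ)

/-- **The creep cap** `ccap := min (max c₀ c₁) (min r₀ r₁)` (so that `c_i ≤ ccap ≤ r_j` can be enforced by truncation). [this work] -/
def ccap : ℕ := min (max (c 0) (c 1)) (min ((fcellsA κ Φ t p D g f).r 0) ((fcellsA κ Φ t p D g f).r 1))

/-- **The truncated creep** `cS i := min (c i) ccap`. [this work] -/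
def cS (i : Fin 2) : ℕ := min (c i) (ccap κ Φ t p D g f c)

/-- `ccap ≤ r j`. [folklore] -/
theorem ccap_le_r (j : Fin 2) : ccap κ Φ t p D g f c ≤ (fcellsA κ Φ t p D g f).r j := by
  have h : ccap κ Φ t p D g f c ≤ min ((fcellsA κ Φ t p D g f).r 0) ((fcellsA κ Φ t p D g f).r 1) := min_le_right _ _
  fin_cases j
  · exact h.trans (min_le_left _ _)
  · exact h.trans (min_le_right _ _)

/-- `cS i ≤ ccap` and `cS i ≤ c i`. [folklore] -/
theorem cS_le (i : Fin 2) : cS κ Φ t p D g f c i ≤ ccap κ Φ t p D g f c ∧ cS κ Φ t p D g f c i ≤ c i := ⟨min_le_right _ _, min_le_left _ _⟩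

/-- **Under the ledger row `c i ≤ r j` (all `i, j`) the truncation is the identity**: `cS i = c i`. [folklore] -/
theorem cS_eq (h : ∀ i j, c i ≤ (fcellsA κ Φ t p D g f).r j) (i : Fin 2) : cS κ Φ t p D g f c i = c i := by
  have hmax : max (c 0) (c 1) ≤ min ((fcellsA κ Φ t p D g f).r 0) ((fcellsA κ Φ t p D g f).r 1) :=
    le_min (max_le (h 0 0) (h 1 0)) (max_le (h 0 1) (h 1 1))
  have hcap : ccap κ Φ t p D g f c = max (c 0) (c 1) := min_eq_left hmax
  unfold cS; rw [hcap]
  fin_cases i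
  · exact min_eq_left (le_max_left _ _)
  · exact min_eq_left (le_max_right _ _)

/-- **THE STAGGERED CELLS OF RECORD OF THE N2 CHAIN** (`PCells2S`): the cells `fcellsA` of the (ζ′) chain with the (truncated) creep `cS` toward the onward quadrant and the
creep bound `ccap` — total in the slot value `c`. [cite: KozmaNitzan2024, §4 p. 25 (the renormalised lattice)] -/
def fcellsS : PCells2S where
  toPCells2 := fcellsA κ Φ t p D g f
  c := fun i => ((cS κ Φ t p D g f c i : ℕ) : ℤ)
  cmax := ccap κ Φ t p D g f c
  hc0 := fun i => Int.natCast_nonneg _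
  hcm := fun i => by exact_mod_cast (cS_le κ Φ t p D g f c i).1
  hcr := fun j => ccap_le_r κ Φ t p D g f c j

/-- The underlying two-unit cells are `fcellsA` (by `rfl`): every number row of the (ζ′)/(ζ″) ledger about `K`, `s`, `r` carries. [folklore] -/
@[simp] theorem fcellsS_toPCells2 : (fcellsS κ Φ t p D g f c).toPCells2 = fcellsA κ Φ t p D g f := rfl

/-- `r`, `s`, `K` of the staggered cells are `fcellsA`'s (by `rfl`). [folklore] -/
theorem fcellsS_r (i : Fin 2) : (fcellsS κ Φ t p D g f c).r i = (fcellsA κ Φ t p D g f).r i := rfl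

/-- `s` of the staggered cells (by `rfl`). [folklore] -/
theorem fcellsS_s (i : Fin 2) : (fcellsS κ Φ t p D g f c).s i = (fcellsA κ Φ t p D g f).s i := rfl

/-- `K` of the staggered cells (by `rfl`). [folklore] -/
theorem fcellsS_K : (fcellsS κ Φ t p D g f c).K = (fcellsA κ Φ t p D g f).K := rfl

/-- The creep field (by `rfl`). [folklore] -/
theorem fcellsS_c (i : Fin 2) : (fcellsS κ Φ t p D g f c).c i = ((cS κ Φ t p D g f c i : ℕ) : ℤ) := rfl

/-- The creep bound field (by `rfl`). [folklore] -/
theorem fcellsS_cmax : (fcellsS κ Φ t p D g f c).cmax = ccap κ Φ t p D g f c := rfl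

/-- **`cmax ≤ r i`** (what the planar files read through `c_le_r/c_le_r_oth/sg_c_bound`). [folklore] -/
theorem fcellsS_cmax_le (i : Fin 2) : (fcellsS κ Φ t p D g f c).cmax ≤ (fcellsA κ Φ t p D g f).r i := ccap_le_r κ Φ t p D g f c i

/-- The creep is at most the slot value. [folklore] -/
theorem fcellsS_c_le (i : Fin 2) : (fcellsS κ Φ t p D g f c).c i ≤ c i := by
  rw [fcellsS_c]; exact_mod_cast (cS_le κ Φ t p D g f c i).2

/-- **Under the ledger row `c i ≤ r j` the creep IS the slot value.** [folklore] -/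
theorem fcellsS_c_eq (h : ∀ i j, c i ≤ (fcellsA κ Φ t p D g f).r j) (i : Fin 2) : (fcellsS κ Φ t p D g f c).c i = c i := by
  rw [fcellsS_c, cS_eq κ Φ t p D g f c h]

/-- With the zero slot value the staggered centre is the (ζ′) centre. [folklore] -/
theorem fcellsS_cenS_zero (v : Site 2) : (fcellsS κ Φ t p D g f 0).cenS v = (fcellsA κ Φ t p D g f).cen v :=
  PCells2S.cenS_eq_cen_of_zero _ (fun i => by rw [fcellsS_c]; simp [cS]) v

/-! ## §2 The column slot at the staggered centre, the schedule, the arrival half-widths -/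

/-- **The column slot of record, read at the STAGGERED centre**: `offNS x := NrepA (cenS x) + 1` (hp-8's `hcolQ` row `‖rep₂ (cenS x)‖₁ + 1 ≤ rQ a x`). [this work] -/
def offNS : Site 2 → ℕ := fun x => NrepA κ Φ t p D g f ((fcellsS κ Φ t p D g f c).cenS x) + 1

/-- **The radius schedule of record over the staggered cells**: `schedOfS S := Prm.schedN S fcellsA offNS` (numbers over the underlying `PCells2`; the column slot at `cenS`).
[this work] -/
def schedOfS (S : Skelφ.Prm.SchedIn) : ConcRadiiG := Skelφ.Prm.schedN S (fcellsA κ Φ t p D g f) (offNS κ Φ t p D g f c)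

/-- The schedule by name. [folklore] -/
theorem schedOfS_eq (S : Skelφ.Prm.SchedIn) : schedOfS κ Φ t p D g f c S = Skelφ.Prm.schedN S (fcellsA κ Φ t p D g f) (offNS κ Φ t p D g f c) := rfl

/-- **`WFS2 (fcellsS …).toPCells2 (schedOfS S)`** for every input block and every slot value. [this work] -/
theorem schedOfS_WFS2 (S : Skelφ.Prm.SchedIn) : Skelφ.WFS2 (fcellsS κ Φ t p D g f c).toPCells2 (schedOfS κ Φ t p D g f c S) := Skelφ.Prm.schedN_WFS2 _ _ _

/-- **The column floor at the staggered centre**: `NrepA (cenS x) + 1 ≤ rQ a x`. [folklore] -/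
theorem colQ_schedOfS (S : Skelφ.Prm.SchedIn) : ∀ a x, NrepA κ Φ t p D g f ((fcellsS κ Φ t p D g f c).cenS x) + 1 ≤ (schedOfS κ Φ t p D g f c S).rQ a x :=
  fun a x => Skelφ.Prm.off_le_schedN_rQ S (fcellsA κ Φ t p D g f) (offNS κ Φ t p D g f c) a x

variable (b : Fin 2 → ℕ)

/-- **THE (TRUNCATED) ARRIVAL HALF-WIDTHS** (in fine cells): `bS i := min (b i) (3·r_i)` — total in the slot value; the truncation is inactive under the ledger row
`b_i ≤ 3·r_i`. [this work] -/
def bS : Fin 2 → ℕ := fun i => min (b i) (3 * (fcellsA κ Φ t p D g f).r i)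

/-- **`bS i ≤ 3·r i`** (SmallMS's `Mb_subset_M` row `hb`), stated over the staggered cells, for EVERY slot value. [folklore] -/
theorem bS_le (i : Fin 2) : bS κ Φ t p D g f b i ≤ 3 * (fcellsS κ Φ t p D g f c).r i := by
  rw [fcellsS_r]; exact min_le_right _ _

/-- `bS i ≤ b i`. [folklore] -/
theorem bS_le_slot (i : Fin 2) : bS κ Φ t p D g f b i ≤ b i := min_le_left _ _

/-- **Under the ledger row `b i ≤ 3·r i` the half-width IS the slot value.** [folklore] -/
theorem bS_eq (h : ∀ i, b i ≤ 3 * (fcellsA κ Φ t p D g f).r i) (i : Fin 2) : bS κ Φ t p D g f b i = b i := min_eq_left (h i)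

/-! ## §3 The slot readings, the scheme of record, the choices, the choice function -/

variable (Pv : PSlot)

/-- **The extensible pair list**: `SMn ∪ extra`. [this work] -/
def SMnP : Finset (ℕ × ℕ) := SMn κ Φ t p D g f ∪ (Pv κ Φ t p D).1

/-- The ledger pairs are listed. [folklore] -/
theorem SMn_subset_SMnP : SMn κ Φ t p D g f ⊆ SMnP κ Φ t p D g f Pv := Finset.subset_union_left

/-- The extra pairs are listed. [folklore] -/
theorem extra_subset_SMnP : (Pv κ Φ t p D).1 ⊆ SMnP κ Φ t p D g f Pv := Finset.subset_union_right

/-- **Pair admissibility of the extensible list.** [folklore] -/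
theorem SMnP_adm_at : ∀ q ∈ SMnP κ Φ t p D g f Pv, D.M₀ ≤ q.1 ∧ D.n₁ q.1 ≤ q.2 := by
  intro q hq
  rcases Finset.mem_union.1 hq with h | h
  · exact SMn_adm_at κ Φ t p D g f q h
  · exact (Pv κ Φ t p D).2 q h

variable (O : OutNS V) (gv fv : Neg.FSlot) (Sv : SSlot) (cv : CSlot) (bv : BSlot) (q : unitInterval)

/-- The box value at the merged record. [this work] -/
def gOf : ℕ := gv κ Φ t p O.merged

/-- The width value at the merged record. [this work] -/
def fOf : ℕ := fv κ Φ t p O.merged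

/-- The creep value at the merged record (and the box/width values). [this work] -/
def cOf : Fin 2 → ℕ := cv κ Φ t p O.merged (gOf κ Φ t p O gv) (fOf κ Φ t p O fv)

/-- The arrival half-widths at the merged record, TRUNCATED at `3r` (`bS`). [this work] -/
def bOf : Fin 2 → ℕ := bS κ Φ t p O.merged (gOf κ Φ t p O gv) (fOf κ Φ t p O fv) (bv κ Φ t p O.merged (gOf κ Φ t p O gv) (fOf κ Φ t p O fv))

/-- `bOf ≤ 3r` for every slot value. [folklore] -/
theorem bOf_le (i : Fin 2) :
    bOf κ Φ t p O gv fv bv i ≤ 3 * (fcellsS κ Φ t p O.merged (gOf κ Φ t p O gv) (fOf κ Φ t p O fv) (cOf κ Φ t p O gv fv cv)).r i :=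
  bS_le κ Φ t p O.merged _ _ _ _ i

/-- **THE SCHEME OF RECORD OF THE N2 CHAIN at `(O, q)`**: `cellGeomSG₂bS` over the oriented (ζ′) fine map `fineOA`, the STAGGERED cells `fcellsS`, root `t`, schedule
`schedOfS (Sv …)`, arrival boxes `bOf` (slot `bv`, truncated at `3r`). [cite: KozmaNitzan2024, §4 pp. 25–27 (Q_v, M_v, E_{v,x}, H^j_{v,x})] -/
def ΓQ : CellGeom V ℕ :=
  Skelφ.cellGeomSG₂bS G (fineOA κ Φ t p O.D O.DT.toDataN O.ori (gOf κ Φ t p O gv) (fOf κ Φ t p O fv))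
    (fcellsS κ Φ t p O.merged (gOf κ Φ t p O gv) (fOf κ Φ t p O fv) (cOf κ Φ t p O gv fv cv)) t
    (schedOfS κ Φ t p O.merged (gOf κ Φ t p O gv) (fOf κ Φ t p O fv) (cOf κ Φ t p O gv fv cv)
      (Sv κ Φ t p O.merged (gOf κ Φ t p O gv) (fOf κ Φ t p O fv) q))
    (bOf κ Φ t p O gv fv bv)

/-- **The face data of the N2 chain at `(O, q)`** (`faceDataSGS` over `fineOA`/`fcellsS`/`schedOfS`). [this work] -/
def FDQ : FaceData V ℕ :=
  Skelφ.faceDataSGS G (fineOA κ Φ t p O.D O.DT.toDataN O.ori (gOf κ Φ t p O gv) (fOf κ Φ t p O fv))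
    (fcellsS κ Φ t p O.merged (gOf κ Φ t p O gv) (fOf κ Φ t p O fv) (cOf κ Φ t p O gv fv cv)) t
    (schedOfS κ Φ t p O.merged (gOf κ Φ t p O gv) (fOf κ Φ t p O fv) (cOf κ Φ t p O gv fv cv)
      (Sv κ Φ t p O.merged (gOf κ Φ t p O gv) (fOf κ Φ t p O fv) q))

/-- **The level data of the N2 chain at `O`** (`levelDataSS` over `fineOA`/`fcellsS`). [this work] -/
def LDQ : LevelData V ℕ :=
  Skelφ.levelDataSS (fineOA κ Φ t p O.D O.DT.toDataN O.ori (gOf κ Φ t p O gv) (fOf κ Φ t p O fv))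
    (fcellsS κ Φ t p O.merged (gOf κ Φ t p O gv) (fOf κ Φ t p O fv) (cOf κ Φ t p O gv fv cv))

/-- The root of the scheme of record is `t` (by `rfl`). [folklore] -/
@[simp] theorem ΓQ_root : (ΓQ κ Φ t p O gv fv Sv cv bv q).root = t := rfl

/-- The base anchor of the scheme of record is `0` (by `rfl`). [folklore] -/
@[simp] theorem ΓQ_a₀ : (ΓQ κ Φ t p O gv fv Sv cv bv q).a₀ = 0 := rfl

/-- The number of stub levels of the scheme of record is the cells' `K` (by `rfl`). [folklore] -/
theorem ΓQ_K : (ΓQ κ Φ t p O gv fv Sv cv bv q).K = (fcellsA κ Φ t p O.merged (gOf κ Φ t p O gv) (fOf κ Φ t p O fv)).K := rfl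

/-- **The arrival box of the scheme of record** (what the (C) residue's `hlastM` and the (R) root leg read): the window span over the SMALL box `Mb bOf v` about the
staggered centre, radius `rM a v` of `schedOfS`. [folklore] -/
theorem ΓQ_M (a : ℕ) (v : Site 2) : (ΓQ κ Φ t p O gv fv Sv cv bv q).M a v =
    Skelφ.VWin G (fineOA κ Φ t p O.D O.DT.toDataN O.ori (gOf κ Φ t p O gv) (fOf κ Φ t p O fv)) t
      (PCells2S.Mb (fcellsS κ Φ t p O.merged (gOf κ Φ t p O gv) (fOf κ Φ t p O fv) (cOf κ Φ t p O gv fv cv)) (bOf κ Φ t p O gv fv bv) v)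
      ((schedOfS κ Φ t p O.merged (gOf κ Φ t p O gv) (fOf κ Φ t p O fv) (cOf κ Φ t p O gv fv cv)
        (Sv κ Φ t p O.merged (gOf κ Φ t p O gv) (fOf κ Φ t p O fv) q)).rM a v) := rfl

/-- **The cube of the scheme of record**: the window span over `Q v` about the staggered centre, radius `rQ a v`. [folklore] -/
theorem ΓQ_Q (a : ℕ) (v : Site 2) : (ΓQ κ Φ t p O gv fv Sv cv bv q).Q a v =
    Skelφ.VWin G (fineOA κ Φ t p O.D O.DT.toDataN O.ori (gOf κ Φ t p O gv) (fOf κ Φ t p O fv)) t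
      ((fcellsS κ Φ t p O.merged (gOf κ Φ t p O gv) (fOf κ Φ t p O fv) (cOf κ Φ t p O gv fv cv)).Q v)
      ((schedOfS κ Φ t p O.merged (gOf κ Φ t p O gv) (fOf κ Φ t p O fv) (cOf κ Φ t p O gv fv cv)
        (Sv κ Φ t p O.merged (gOf κ Φ t p O gv) (fOf κ Φ t p O fv) q)).rQ a v) := rfl

/-- The far region of the scheme of record: the window span over the slack two-block far region `FarNS₂ v δ` (the far block about the staggered NEIGHBOUR), radius
`rE a v δ`. [folklore] -/
theorem ΓQ_Efar (a : ℕ) (v : Site 2) (δ : MDir) : (ΓQ κ Φ t p O gv fv Sv cv bv q).Efar a v δ =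
    Skelφ.VWin G (fineOA κ Φ t p O.D O.DT.toDataN O.ori (gOf κ Φ t p O gv) (fOf κ Φ t p O fv)) t
      ((fcellsS κ Φ t p O.merged (gOf κ Φ t p O gv) (fOf κ Φ t p O fv) (cOf κ Φ t p O gv fv cv)).FarNS₂ v δ)
      ((schedOfS κ Φ t p O.merged (gOf κ Φ t p O gv) (fOf κ Φ t p O fv) (cOf κ Φ t p O gv fv cv)
        (Sv κ Φ t p O.merged (gOf κ Φ t p O gv) (fOf κ Φ t p O fv) q)).rE a v δ) := rfl

/-- The admissible anchors of the scheme of record are `{a, a+1}` (by `rfl`). [folklore] -/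
theorem ΓQ_anchSet (a : ℕ) (v : Site 2) : (ΓQ κ Φ t p O gv fv Sv cv bv q).anchSet a v = {a, a + 1} := rfl

variable (hC : Φ.CylSubcritical p)

/-- **THE N2 CHOICES at `(κ, Φ, t, p)` with the six slots** — `δI, m₀, Sz, SMn` as the record's (`SMnP` with the extra pairs), `Γ := ΓQ`, `FD := FDQ`, `LD := LDQ`.
[cite: KozmaNitzan2024, §4 Theorem 6 (pp. 25–31)] -/
def choiceAtQ : ChoiceNQ κ Φ t p hC where
  δI := Neg.δI κ Φ
  m₀ := Neg.m₀
  Sz := fun O => Neg.Sz O.merged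
  SMn := fun O => SMnP κ Φ t p O.merged (gOf κ Φ t p O gv) (fOf κ Φ t p O fv) Pv
  Γ := fun O q => ΓQ κ Φ t p O gv fv Sv cv bv q
  FD := fun O q => FDQ κ Φ t p O gv fv Sv cv q
  LD := fun O _ => LDQ κ Φ t p O gv fv cv
  δI_pos := Neg.δI_pos κ Φ
  δI_lt_one := Neg.δI_lt_one κ Φ
  S_adm := fun O _ => ⟨Neg.Sz_adm O.merged, SMnP_adm_at κ Φ t p O.merged _ _ Pv⟩

end Values

end NegB

/-- **THE CHOICE FUNCTION OF RECORD OF THE FRAMES-ONLY NODE, six slots** (box `gv`, width `fv`, extra pairs `Pv`, fibre block `Sv`, creep `cv`, arrival box `bv`):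
a `ChoiceFnNQ` over `κ : Consts` (the closure for it is p3-g15's `samePDropOfSkeletonFrm₁_of_choiceFnNQL`). [cite: KozmaNitzan2024, §4 Theorem 6 (pp. 25–31)] -/
def frmChoiceAllQ (gv fv : Neg.FSlot) (Pv : NegB.PSlot) (Sv : NegB.SSlot) (cv : NegB.CSlot) (bv : NegB.BSlot) : ChoiceFnNQ :=
  fun κ _ _ _ _ _ Φ _ t _ _ p _ _ hC => NegB.choiceAtQ κ Φ t p Pv gv fv Sv cv bv hC

/-- `frmChoiceAllQ` unfolds to `NegB.choiceAtQ` (by `rfl`). [folklore] -/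
theorem frmChoiceAllQ_eq (gv fv : Neg.FSlot) (Pv : NegB.PSlot) (Sv : NegB.SSlot) (cv : NegB.CSlot) (bv : NegB.BSlot) (κ : Consts) {V : Type} [DecidableEq V] [Countable V]
    (G : SimpleGraph V) [G.LocallyFinite] (Φ : PlanarSkeletonFrmFrom G) (hg : ¬ HasExponentialGrowth G) (t : V) (ht : t ∈ Φ.types) (h1 : Φ.types = {t})
    (p : unitInterval) (hp0 : 0 < (p : ℝ)) (hp1 : (p : ℝ) < 1) (hC : Φ.CylSubcritical p) :
    frmChoiceAllQ gv fv Pv Sv cv bv κ G Φ hg t ht h1 p hp0 hp1 hC = NegB.choiceAtQ κ Φ t p Pv gv fv Sv cv bv hC := rfl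

/-- The scheme of the choice function of record at `(O, q)` is `⟨ΓQ, q, κ.δ⟩` (by `rfl`) — the form the (R)/(F)/(C) wrappers read. [folklore] -/
theorem frmChoiceAllQ_scheme (gv fv : Neg.FSlot) (Pv : NegB.PSlot) (Sv : NegB.SSlot) (cv : NegB.CSlot) (bv : NegB.BSlot) (κ : Consts) {V : Type} [DecidableEq V] [Countable V]
    (G : SimpleGraph V) [G.LocallyFinite] (Φ : PlanarSkeletonFrmFrom G) (hg : ¬ HasExponentialGrowth G) (t : V) (ht : t ∈ Φ.types) (h1 : Φ.types = {t})
    (p : unitInterval) (hp0 : 0 < (p : ℝ)) (hp1 : (p : ℝ) < 1) (hC : Φ.CylSubcritical p) (O : Skelφ.StepI.OutNS V) (q : unitInterval) :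
    (frmChoiceAllQ gv fv Pv Sv cv bv κ G Φ hg t ht h1 p hp0 hp1 hC).scheme O q = ⟨NegB.ΓQ κ Φ t p O gv fv Sv cv bv q, q, κ.δ⟩ := rfl

end PlanarSkeletonFrmFrom

end Summit.CriticalPhenomena.PercolationContinuityZ3.Theorems.Transplant

end
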